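import Literature.Analysis.FluidPDE.ForwardDSSLocalEnergy
import HarnessLib

/-!
# Forward DSS solutions: the scaling laws (3.6) of Bradshaw–Tsai 2019 and their uses on p. 9

Analysis/FluidPDE proof file (theorems only) in the decomposition of
`Literature.Analysis.FluidPDE.bradshawTsai2019_prop_3_1` (Bradshaw–Tsai, Analysis & PDE 12 (2019)
= arXiv:1801.08060, Prop. 3.1; facts `bradshawTsai2019_prop_3_1_scheme` and
`bradshawTsai2019_prop_3_1_approximation` of `ForwardDSSLocalEnergy`, `ForwardDSSLocalEnergyLimit`).
The remaining analytic input there is the a priori estimate (3.12) for the `λ`-DSS approximants,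
whose proof (pp. 9–10) repeatedly moves local `L^q`-masses along the scaling orbit by

> (3.6) "for any `k ∈ ℤ` and `q ∈ [1,∞)`, since `v_ε(x,t) = λᵏ v_ε(λᵏx, λ^{2k}t)`,
> `∫_{B_{λᵏ}} |v_ε(x,t)|^q dx = λ^{(3−q)k} ∫_{B₁} |v_ε(x, λ^{-2k}t)|^q dx`."

This file proves (3.6) for a `γ`-DSS field (`γ > 0`; `γ = λᵏ`) on a finite-dimensional space
and for every real exponent `q ≥ 0`, in the sliced and in the space–time form, and the three
consequences printed on p. 9 in the `ℝ≥0∞`-valued bookkeeping of `ForwardDSSLocalEnergy`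
(`α(t) = ballEnergy`, `α̃(t) = supBallEnergy`):

* `setLIntegral_ball_enorm_rpow_eq_of_dss` — (3.6): `∫_{B_{γr}} |u(t)|^q = γ^{n−q} ∫_{B_r} |u(γ⁻²t)|^q`;
* `setLIntegral_cylinder_enorm_rpow_eq_of_dss` — its space–time form
  `∫₀^{γ⁻²t}∫_{B_r} |u|^q = γ^{q−n−2} ∫₀ᵗ∫_{B_{γr}} |u|^q`;
* `setLIntegral_ball_enorm_sq_le_supBallEnergy` — "`‖v_ε(s)‖²_{L²(B_λ)} = λ ‖v_ε(λ⁻²s)‖²_{L²(B₁)} ≤ λ α̃_ε(s)`"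
  (and the `B_{λ²}` version with `λ²`, used for `π_far`);
* `setLIntegral_cylinder_enorm_sq_le_of_dss` — the second term of (3.7):
  "`∫₀ᵗ∫_{B_λ} |v_ε|² ≤ C λ³ ∫₀^{t/λ²}∫_{B₁} |v_ε|² ≤ C(λ) ∫₀ᵗ α̃_ε(s) ds`" with `C(λ) = λ³`;
* `setLIntegral_cylinder_enorm_cube_le_of_dss` — the cubic term: "Re-scaling the non-mollified
  term … `∫₀ᵗ∫_{B_λ} |v_ε|³ ≤ C(λ) ∫₀^{t/λ²}∫_{B₁} |v_ε|³`" with `C(λ) = λ²` (an equality), hence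
  `≤ λ² ∫₀ᵗ∫_{B₁} |v_ε|³`.

Tools: the change of variables of `SpaceTimeRescaling` (`setLIntegral_enorm_rpow_stRescale`,
`stAffine_preimage_cylinder`) and of `ForwardDSSExtension`
(`setLIntegral_eq_mul_setLIntegral_preimage_smul`, `apply_smul_of_isDiscretelySelfSimilar`,
`smul_stPull_eq_self`; the case `q = 2` of the sliced law is the accepted
`BradshawTsai2019.setLIntegral_ball_enorm_sq_eq_of_dss` there), and Tonelli in the inequality
form `lintegral_prod_le` (no measurability needed).

## References

* Z. Bradshaw, T.-P. Tsai, Analysis & PDE 12 (2019) 1943–1962 = arXiv:1801.08060, §3, (3.6) and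
  the estimates of the second and of the cubic term of (3.7), p. 9; the bound for `π_far`, p. 10
  [BradshawTsai2019].
-/

noncomputable section

open MeasureTheory Set Function Filter Topology TopologicalSpace Metric Module
open scoped NNReal ENNReal

namespace Literature.Analysis.FluidPDE

namespace BradshawTsai2019

/-! ## (3.6) on a finite-dimensional space -/

section General

variable {E : Type*} [NormedAddCommGroup E] [InnerProductSpace ℝ E] [FiniteDimensional ℝ E]
  [MeasurableSpace E] [BorelSpace E]
variable {F : Type*} [NormedAddCommGroup F] [NormedSpace ℝ F]

/-- **Bradshaw–Tsai 2019, (3.6), sliced form, any exponent.** For a `γ`-DSS field `u` (`γ > 0`),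
`q ≥ 0`, `r, t ∈ ℝ`: `∫_{B_{γr}} |u(x,t)|^q dx = γⁿ γ^{-q} ∫_{B_r} |u(y, γ⁻²t)|^q dy`
(print, `n = 3`, `γ = λᵏ`: "`∫_{B_{λᵏ}} |v_ε(x,t)|^q dx = λ^{(3−q)k} ∫_{B₁} |v_ε(x,λ^{-2k}t)|^q dx`").
[cite: BradshawTsai2019, §3 (3.6)] -/
theorem setLIntegral_ball_enorm_rpow_eq_of_dss {γ : ℝ} (hγ : 0 < γ) {u : ℝ → E → F}
    (hu : IsDiscretelySelfSimilar γ u) {q : ℝ} (hq : 0 ≤ q) (r t : ℝ) :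
    ∫⁻ x in ball (0 : E) (γ * r), ‖u t x‖ₑ ^ q =
      ENNReal.ofReal (γ ^ finrank ℝ E) * ENNReal.ofReal γ⁻¹ ^ q *
        ∫⁻ y in ball (0 : E) r, ‖u ((γ ^ 2)⁻¹ * t) y‖ₑ ^ q := by
  have hpre : (fun y : E => γ • y) ⁻¹' ball (0 : E) (γ * r) = ball 0 r := by
    ext y
    simp only [mem_preimage, mem_ball_zero_iff, norm_smul, Real.norm_eq_abs, abs_of_pos hγ]
    exact ⟨fun h => lt_of_mul_lt_mul_left h hγ.le, fun h => mul_lt_mul_of_pos_left h hγ⟩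
  rw [setLIntegral_eq_mul_setLIntegral_preimage_smul hγ _ (ball (0 : E) (γ * r)), hpre,
    mul_assoc]
  congr 1
  have key : ∀ y : E, ‖u t (γ • y)‖ₑ ^ q =
      ENNReal.ofReal γ⁻¹ ^ q * ‖u ((γ ^ 2)⁻¹ * t) y‖ₑ ^ q := by
    intro y
    rw [apply_smul_of_isDiscretelySelfSimilar hγ.ne' hu, enorm_smul,
      ENNReal.mul_rpow_of_nonneg _ _ hq, Real.enorm_eq_ofReal (inv_nonneg.2 hγ.le)]
  simp_rw [key]
  rw [lintegral_const_mul' _ _ (ENNReal.rpow_ne_top_of_nonneg hq ENNReal.ofReal_ne_top)]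

/-- **Bradshaw–Tsai 2019, (3.6), space–time form, any exponent.** For a `γ`-DSS field `u`
(`γ > 0`), `q ≥ 0`: `∫₀^{γ⁻²t}∫_{B_r} |u|^q = γ^q (γ² γⁿ)⁻¹ ∫₀ᵗ∫_{B_{γr}} |u|^q` (the substitution
`(s, y) = (γ⁻²t', γ⁻¹x)`; p. 9: "`∫₀ᵗ∫_{B_λ}|v_ε|² ≤ Cλ³∫₀^{t/λ²}∫_{B₁}|v_ε|²`", "Re-scaling the
non-mollified term and making the obvious change of variables"). [cite: BradshawTsai2019, §3 (3.6)] -/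
theorem setLIntegral_cylinder_enorm_rpow_eq_of_dss {γ : ℝ} (hγ : 0 < γ) {u : ℝ → E → F}
    (hu : IsDiscretelySelfSimilar γ u) {q : ℝ} (hq : 0 ≤ q) (r t : ℝ) :
    ∫⁻ z in Ioo 0 ((γ ^ 2)⁻¹ * t) ×ˢ ball (0 : E) r, ‖u z.1 z.2‖ₑ ^ q =
      ‖γ‖ₑ ^ q * ENNReal.ofReal (γ * γ * γ ^ finrank ℝ E)⁻¹ *
        ∫⁻ z in Ioo 0 t ×ˢ ball (0 : E) (γ * r), ‖u z.1 z.2‖ₑ ^ q := by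
  have key := setLIntegral_enorm_rpow_stRescale (E := E) (F := F) (mul_pos hγ hγ) hγ 0 (0 : E) γ
    u (Ioo 0 t ×ˢ ball (0 : E) (γ * r)) hq
  rw [smul_stPull_eq_self hu, stAffine_preimage_cylinder (mul_pos hγ hγ) hγ] at key
  have h1 : Ioo ((0 - 0) / (γ * γ)) ((t - 0) / (γ * γ)) = Ioo 0 ((γ ^ 2)⁻¹ * t) := by
    rw [sub_zero, sub_zero, zero_div, sq, div_eq_inv_mul]
  have h2 : ball (γ⁻¹ • ((0 : E) - 0)) (γ * r / γ) = ball (0 : E) r := by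
    rw [sub_zero, smul_zero, mul_div_cancel_left₀ _ hγ.ne']
  rw [h1, h2] at key
  exact key

end General

/-! ## The three uses on p. 9–10 (`E = ℝ³`, `q = 2, 3`, `γ = λ`, `λ²`) -/

section R3

variable {c : ℝ} {w : ℝ → EuclideanSpace ℝ (Fin 3) → EuclideanSpace ℝ (Fin 3)}

/-- `‖v(s)‖²_{L²(B_λ)} = λ α(λ⁻²s)`: (3.6) with `q = 2`, `k = 1` in the `ballEnergy` notation.
[cite: BradshawTsai2019, §3 (3.6)] -/
theorem setLIntegral_ball_enorm_sq_eq_ballEnergy (hc : 0 < c) (hw : IsDiscretelySelfSimilar c w)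
    (s : ℝ) :
    ∫⁻ x in ball (0 : EuclideanSpace ℝ (Fin 3)) c, ‖w s x‖ₑ ^ 2 = ENNReal.ofReal c * ballEnergy w ((c ^ 2)⁻¹ * s) := by
  have h := setLIntegral_ball_enorm_sq_eq_of_dss hc hw 1 s
  rw [mul_one] at h
  rw [h, ballEnergy, finrank_euclideanSpace_fin, ← ENNReal.ofReal_pow (inv_nonneg.2 hc.le),
    ← ENNReal.ofReal_mul (by positivity)]
  congr 2
  field_simp

/-- **"`‖v_ε(s)‖²_{L²(B_λ)} ≤ λ α̃_ε(s)`"** for `s > 0` (the sliced law and `λ⁻²s ∈ (0, s]`; used for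
the far-field pressure, p. 10, and throughout p. 9). [cite: BradshawTsai2019, §3 (3.6) and p. 10] -/
theorem setLIntegral_ball_enorm_sq_le_supBallEnergy (hc : 1 < c) (hw : IsDiscretelySelfSimilar c w)
    {s : ℝ} (hs : 0 < s) :
    ∫⁻ x in ball (0 : EuclideanSpace ℝ (Fin 3)) c, ‖w s x‖ₑ ^ 2 ≤ ENNReal.ofReal c * supBallEnergy w s := by
  have hc0 : 0 < c := zero_lt_one.trans hc
  rw [setLIntegral_ball_enorm_sq_eq_ballEnergy hc0 hw]
  refine mul_le_mul' le_rfl (ballEnergy_le_supBallEnergy w ⟨by positivity, ?_⟩)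
  have h1 : (c ^ 2)⁻¹ ≤ 1 := inv_le_one_of_one_le₀ (one_le_pow₀ hc.le)
  calc (c ^ 2)⁻¹ * s ≤ 1 * s := mul_le_mul_of_nonneg_right h1 hs.le
    _ = s := one_mul s

/-- The same on `B_{λ²}`: `‖v_ε(s)‖²_{L²(B_{λ²})} ≤ λ² α̃_ε(s)` for `s > 0` ("the right hand side
determined at time `λ⁻⁴s`", p. 9; the far-field bound, p. 10). [cite: BradshawTsai2019, §3 (3.6) and p. 10] -/
theorem setLIntegral_ball_sq_enorm_sq_le_supBallEnergy (hc : 1 < c)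
    (hw : IsDiscretelySelfSimilar c w) {s : ℝ} (hs : 0 < s) :
    ∫⁻ x in ball (0 : EuclideanSpace ℝ (Fin 3)) (c ^ 2), ‖w s x‖ₑ ^ 2 ≤ ENNReal.ofReal (c ^ 2) * supBallEnergy w s := by
  have hc2 : 1 < c ^ 2 := one_lt_pow₀ hc two_ne_zero
  exact setLIntegral_ball_enorm_sq_le_supBallEnergy hc2 (isDiscretelySelfSimilar_pow hw 2) hs

/-- **The second term of (3.7)** (p. 9): for a `λ`-DSS field and `t > 0`,
`∫₀ᵗ∫_{B_λ} |v_ε|² = λ³ ∫₀^{t/λ²}∫_{B₁} |v_ε|² ≤ λ³ ∫₀ᵗ α̃_ε(s) ds` ("using the scaling properties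
(3.6) of `v_ε`"; Tonelli and `α ≤ α̃`, `t/λ² ≤ t`). [cite: BradshawTsai2019, §3 p. 9 (second term of (3.7))] -/
theorem setLIntegral_cylinder_enorm_sq_le_of_dss (hc : 1 < c) (hw : IsDiscretelySelfSimilar c w)
    {t : ℝ} (ht : 0 < t) :
    ∫⁻ z in Ioo 0 t ×ˢ ball (0 : EuclideanSpace ℝ (Fin 3)) c, ‖w z.1 z.2‖ₑ ^ 2 ≤
      ENNReal.ofReal (c ^ 3) * ∫⁻ s in Ioo 0 t, supBallEnergy w s := by
  have hc0 : 0 < c := zero_lt_one.trans hc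
  -- (3.6) in space–time: `∫₀^{t/λ²}∫_{B₁} |w|² = λ² (λ²λ³)⁻¹ ∫₀ᵗ∫_{B_λ} |w|²`
  have key := setLIntegral_cylinder_enorm_rpow_eq_of_dss (E := EuclideanSpace ℝ (Fin 3)) hc0 hw zero_le_two 1 t
  simp only [ENNReal.rpow_two, mul_one, finrank_euclideanSpace_fin] at key
  have hconst : ‖c‖ₑ ^ 2 * ENNReal.ofReal (c * c * c ^ 3)⁻¹ = (ENNReal.ofReal (c ^ 3))⁻¹ := by
    rw [Real.enorm_eq_ofReal hc0.le, ← ENNReal.ofReal_pow hc0.le, ← ENNReal.ofReal_mul (by positivity),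
      ← ENNReal.ofReal_inv_of_pos (by positivity)]
    congr 1
    field_simp
  rw [hconst] at key
  have h3 : ENNReal.ofReal (c ^ 3) ≠ 0 := (ENNReal.ofReal_pos.2 (by positivity)).ne'
  have hbig : ∫⁻ z in Ioo 0 t ×ˢ ball (0 : EuclideanSpace ℝ (Fin 3)) c, ‖w z.1 z.2‖ₑ ^ 2 =
      ENNReal.ofReal (c ^ 3) * ∫⁻ z in Ioo 0 ((c ^ 2)⁻¹ * t) ×ˢ ball (0 : EuclideanSpace ℝ (Fin 3)) 1, ‖w z.1 z.2‖ₑ ^ 2 := by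
    rw [key, ← mul_assoc, ENNReal.mul_inv_cancel h3 ENNReal.ofReal_ne_top, one_mul]
  rw [hbig]
  refine mul_le_mul' le_rfl ?_
  -- Tonelli (inequality form) and `α(s) ≤ α̃(s)`, then enlarge the time interval
  have ht' : (c ^ 2)⁻¹ * t ≤ t := by
    have h1 : (c ^ 2)⁻¹ ≤ 1 := inv_le_one_of_one_le₀ (one_le_pow₀ hc.le)
    calc (c ^ 2)⁻¹ * t ≤ 1 * t := mul_le_mul_of_nonneg_right h1 ht.le
      _ = t := one_mul t
  calc ∫⁻ z in Ioo 0 ((c ^ 2)⁻¹ * t) ×ˢ ball (0 : EuclideanSpace ℝ (Fin 3)) 1, ‖w z.1 z.2‖ₑ ^ 2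
      ≤ ∫⁻ s in Ioo 0 ((c ^ 2)⁻¹ * t), ∫⁻ x in ball (0 : EuclideanSpace ℝ (Fin 3)) 1, ‖w s x‖ₑ ^ 2 := by
        rw [Measure.volume_eq_prod, ← Measure.prod_restrict]
        exact lintegral_prod_le _
    _ ≤ ∫⁻ s in Ioo 0 ((c ^ 2)⁻¹ * t), supBallEnergy w s :=
        setLIntegral_mono' measurableSet_Ioo fun s hs =>
          ballEnergy_le_supBallEnergy w ⟨hs.1, le_rfl⟩
    _ ≤ ∫⁻ s in Ioo 0 t, supBallEnergy w s :=
        lintegral_mono_set (Ioo_subset_Ioo le_rfl ht')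

/-- **The cubic term, re-scaled** (p. 9): for a `λ`-DSS field,
`∫₀ᵗ∫_{B_λ} |v_ε|³ = λ² ∫₀^{t/λ²}∫_{B₁} |v_ε|³ ≤ λ² ∫₀ᵗ∫_{B₁} |v_ε|³` (`t > 0`; print: "Re-scaling the
non-mollified term and making the obvious change of variables results in the estimate
`∫₀ᵗ∫_{B_λ}|v_ε|³ ≤ C(λ)∫₀^{t/λ²}∫_{B₁}|v_ε|³ ≤ C(λ)∫₀ᵗ∫|v_ε|³φ^{3/2}`"; the last step uses `φ = 1` on
`B₁ × [0,1]` and is left to the consumer). [cite: BradshawTsai2019, §3 p. 9 (cubic term)] -/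
theorem setLIntegral_cylinder_enorm_cube_le_of_dss (hc : 1 < c) (hw : IsDiscretelySelfSimilar c w)
    {t : ℝ} (ht : 0 < t) :
    ∫⁻ z in Ioo 0 t ×ˢ ball (0 : EuclideanSpace ℝ (Fin 3)) c, ‖w z.1 z.2‖ₑ ^ (3 : ℝ) ≤
      ENNReal.ofReal (c ^ 2) * ∫⁻ z in Ioo 0 t ×ˢ ball (0 : EuclideanSpace ℝ (Fin 3)) 1, ‖w z.1 z.2‖ₑ ^ (3 : ℝ) := by
  have hc0 : 0 < c := zero_lt_one.trans hc
  have key := setLIntegral_cylinder_enorm_rpow_eq_of_dss (E := EuclideanSpace ℝ (Fin 3)) hc0 hw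
    (by norm_num : (0 : ℝ) ≤ 3) 1 t
  simp only [mul_one, finrank_euclideanSpace_fin] at key
  have hconst : ‖c‖ₑ ^ (3 : ℝ) * ENNReal.ofReal (c * c * c ^ 3)⁻¹ = (ENNReal.ofReal (c ^ 2))⁻¹ := by
    rw [Real.enorm_eq_ofReal hc0.le, ENNReal.ofReal_rpow_of_nonneg hc0.le (by norm_num),
      show ((3 : ℝ)) = ((3 : ℕ) : ℝ) by norm_num, Real.rpow_natCast,
      ← ENNReal.ofReal_mul (by positivity),
      ← ENNReal.ofReal_inv_of_pos (by positivity)]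
    congr 1
    field_simp
  rw [hconst] at key
  have h2 : ENNReal.ofReal (c ^ 2) ≠ 0 := (ENNReal.ofReal_pos.2 (by positivity)).ne'
  have hbig : ∫⁻ z in Ioo 0 t ×ˢ ball (0 : EuclideanSpace ℝ (Fin 3)) c, ‖w z.1 z.2‖ₑ ^ (3 : ℝ) =
      ENNReal.ofReal (c ^ 2) *
        ∫⁻ z in Ioo 0 ((c ^ 2)⁻¹ * t) ×ˢ ball (0 : EuclideanSpace ℝ (Fin 3)) 1, ‖w z.1 z.2‖ₑ ^ (3 : ℝ) := by
    rw [key, ← mul_assoc, ENNReal.mul_inv_cancel h2 ENNReal.ofReal_ne_top, one_mul]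
  rw [hbig]
  refine mul_le_mul' le_rfl (lintegral_mono_set (Set.prod_mono (Ioo_subset_Ioo le_rfl ?_) Subset.rfl))
  have h1 : (c ^ 2)⁻¹ ≤ 1 := inv_le_one_of_one_le₀ (one_le_pow₀ hc.le)
  calc (c ^ 2)⁻¹ * t ≤ 1 * t := mul_le_mul_of_nonneg_right h1 ht.le
    _ = t := one_mul t

end R3

end BradshawTsai2019

end Literature.Analysis.FluidPDE

end
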